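import Literature.NumberTheory.EllipticCurves.X049CanonicalPAdicHeightSqTwoBinderFreeProofs
import HarnessLib

/-!
# The CM sigma function of the twists `49a1^{(d)}`, `d ≡ 1 (mod 4)`, of `X₀(49)` at `p = 2`:
Perrin-Riou's Lemme 2 for `v | 2` on the whole good-at-`2` twist family, and `(Σ₂, c₂) = (σ_CM², 0)`
(proofs only)

Topic `NumberTheory/EllipticCurves` (theorems only; no definition, no named fact, no instance). Cell
`bsd-goldfeld`, typer seat `bsd-goldfeld-ty` g12, order (α) of the cell's planner (g26 (cxii)): the
objects of LTYZ Thm 1.1 (ii) / BCST Thm A at `p = 2` in the cell are not `X₀(49)` itself (whose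
rational and `ℚ(√-7)`-points are torsion) but its quadratic twists of positive rank with GOOD reduction
at `2`, i.e. `49a1^{(d)}` with `d ≡ 1 (mod 4)`. This file carries the `p = 2` sigma-function road of
`X049CMSigmaSqTwoProofs` (the case `d = 1`) over to ALL these twists at once, on the parametric model

  `V_d = [1, -(3d+1)/4, 0, -2d², -d³]`  (`b`-invariants `(-3d, -4d², -4d³)` = those of `49a1`
  weighted by `(d, d², d³)`, so `V_d ≅ 49a1^{(d)}`; `Δ(V_d) = -343·d⁶`, `a₁ = 1`: for `d ∈ ℤ₂` it is
  a `ℤ₂`-integral model with good ORDINARY reduction at `2`, both classes `d ≡ 1, 5 (mod 8)`;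
  over `ℚ`, with `d = 4k + 1`, `W_k = [1, -(3k+1), 0, -2(4k+1)², -(4k+1)³]` has integer coefficients
  and is globally minimal whenever `d` is squarefree).

Perrin-Riou [Perrin-Riou 1984, Ch. III §1.2, pp. 53–56] attaches to a CM elliptic curve and a place
`v | p` with `p` split in the CM field the formal CM sigma function `σ_v` and proves **Lemme 2**:
`σ_v(L_v(t)) ∈ t(1 + tR⟦t⟧)`, by the functional equation of `h = σ_v/t` under the complex
multiplication `[π*]`, `N(π*) = p`, and a coefficient induction («ce quotient commence par
`1 - (π*^m - p)a_m t^m`», p. 55). As in the `d = 1` file, her argument is carried out in the SQUARED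
currency of the tree (`WeierstrassCurve.IsMazurTateSigmaSqPair`, `PadicSigmaSq.lean`):

* **§1–§2, the complex multiplication `[ϖ]`, `ϖ = 3 + 4e = (1 ± √-7)/2` (`4e² + 5e + 2 = 0`), on the
  formal group of `V_d`, explicitly.** Twisting multiplies `2`-torsion abscissae by `d` and Vélu's
  constant by `d²`: the kernel of `[ϖ]` on `V_d` is `{O, (e_d, -e_d/2)}`, `e_d = d·e`, Vélu's
  `t_d = d²t`, `t = -(14 + 21e)/4`, and `[ϖ]` = Vélu's `2`-isogeny [Vélu 1971] composed with the
  isomorphism `(u, r) = (ϖ⁻¹, e_dϖ⁻²)` back to `V_d`, so that `ϖ²x([ϖ]P) = x + t_d/(x - e_d) + e_d`.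
  `twist_exists_cmTwoIsogenyDatum` produces, over any `ℚ_p` containing `e` and for any `V/ℚ_p` with
  the `a`-invariants of `V_d` (`4a₂ = -(3d+1)`), a series `T ∈ zℚ_p⟦z⟧` with `log_V(T) = ϖ·log_V`
  and that `x`-relation: the candidate `T = 2ϖzAB/Q` (`A = X - e_d z²`, `B = X² + (t_d - e_d²)z⁴`,
  `Q = -(A² - t_d z⁴)Ỹ + ϖzAB`, `Ỹ = (z - 2)X` since `a₁ = 1`, `a₃ = 0`) is checked against the
  Weierstrass equation of `V_d` by three polynomial identities with machine-generated integer
  cofactors — `phi_identity_twist` (the new one: `Q² = 4AB³ + 2ϖzABQ - (3d+1)ϖ²z²A²B² -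
  8d²ϖ⁴z⁴A³B - 4d³ϖ⁶z⁶A⁴` modulo the curve relation, `4e² + 5e + 2` and `4t + 14 + 21e`, times
  `16`), `heq_identity_twist`, `star_identity_twist` (the chain rule, an identity in free atoms) —
  the uniqueness of the formal chart (`formalXMulSq_subst_eq_of_sq_eq`, `formalEta_subst_mul_eq`) and
  `ω(T)·T' = ϖ·ω ⟹ log(T) = ϖ·log`. (As the model `V_d` is not the weight-scaling of `V_1` in the
  chart `(z, X = z²x)` — `a₁ = 1` is fixed — the identities were re-derived for `V_d`'s
  `a`-invariants, not obtained by substitution from `d = 1`.)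
* **§3, `p = 2`, any `2`-integral `V/ℚ₂` with these `a`-invariants, `d ∈ ℤ₂`.** `e ∈ ℤ₂` (Hensel),
  `ϖ ∈ ℤ₂ˣ`, `e_d = de ∈ ℤ₂`, `T = exp(ϖ log) ∈ zℤ₂⟦z⟧`, CM constant `c = (e_d - r₀)/(ϖ² - 2) = 0`
  (`r₀ = e_d`); the datum feeds `isMazurTateSigmaSqPair_sq_of_cmTwoIsogeny_two`
  (`CMSigmaSqIntegralityProofs`): `twist_isMazurTateSigmaSqPair_sq_two` — for EVERY normalised odd
  formal solution `σ` of `x = -D(Dσ/σ)` on `V`, `(σ², 0)` is a Mazur–Tate sigma-squared pair (Lemme 2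
  at `v | 2` for the twist, binder-free); with the tree's finite-height uniqueness at `2` for `a₁` odd
  (`existsUnique_isMazurTateSigmaSqPair_of_exists`, `unbounded_formalLog_two_of_norm_a₁_eq_one`):
  `twist_existsUnique_isMazurTateSigmaSqPair_two` and **`twist_padicSigmaSq_eq_sq_two`: `Σ₂(V) = σ_CM²`,
  `c₂(V) = 0` — statement (L1) of the cell's audit at `p = 2` for every good twist, no hypothesis.**
* **§4, over `ℚ`.** For `W_k = [1, -(3k+1), 0, -2(4k+1)², -(4k+1)³]` (`k ∈ ℤ`; any `W/ℚ` equal to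
  it): `Δ = -343(4k+1)⁶`, `W_k` is elliptic and `ℤ`-integral; `cm7Twist_isMazurTateSigmaSqPair_sq_two`,
  `cm7Twist_existsUnique_isMazurTateSigmaSqPair_two`, `cm7Twist_padicSigmaSq_eq_sq_two` ((L1) at `2`);
  and, through the tree's binder-free cores `exists(Unique)_isCanonicalSq(K)_of_exists`, the canonical
  `2`-adic height datum in sigma-squared form: `cm7Twist_exists_isCanonicalSq_two` (over `ℚ`),
  `cm7Twist_existsUnique_isCanonicalSq_two` (given `[W.IsGloballyMinimal]`, e.g. `4k+1` squarefree),
  `cm7Twist_exists_isCanonicalSqK_two_of_discr_mod_eight` / `cm7Twist_existsUnique_isCanonicalSqK_two`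
  / `…_of_discr_eq_neg_seven` (over quadratic `K` with `d_K ≡ 1 (mod 8)`, e.g. `ℚ(√-7)`, given
  `[(W.baseChange K).IsGloballyMinimal]` for uniqueness).

So on every twist `49a1^{(d)}`, `d ≡ 1 (mod 4)` — the positive-rank half of which is the object of
LTYZ Thm 1.1 (ii) at `p = 2` — the `p = 2` receptacle of the tree is inhabited, uniquely, by a datum
whose local ingredient at `2` is Perrin-Riou's `σ_v²`, with no printed hypothesis. What is NOT claimed:
anything about heights of specific points, the normalisation bridge to Perrin-Riou's `h_ρ`, Bertrand's
non-degeneracy (R2), or BSD; global minimality of `W_k` is taken as an instance hypothesis where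
uniqueness over `ℚ`/`K` needs it (the Summit side owns the identification of its twist models with
`W_k`; `PadicSigmaSqVariableChangeProofs` transports `Σ₂` along `ℤ₂`-integral isomorphisms).

## References
* [Perrin-Riou 1984] B. Perrin-Riou, *Arithmétique des courbes elliptiques et théorie d'Iwasawa*,
  Mém. SMF 17 (1984), Ch. III §1.2, pp. 53–56 (définition de `σ_v`, Lemme 2, «invariance par rapport
  au modèle» p. 53). [cite: Perrinriou1984, Ch. III §1.2 Lemme 2]
* [Vélu 1971] J. Vélu, *Isogénies entre courbes elliptiques*, C. R. Acad. Sci. 273 (1971) 238–241. [cite: Velu1971, formules (7)–(11)]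
* [Silverman AEC] J. H. Silverman, *The Arithmetic of Elliptic Curves*, 2nd ed., III.1, III.4, IV.1–IV.5,
  X.5 (quadratic twists). [cite: SilvermanAEC2009, IV.2 and IV.5]
* [Mazur–Tate 1991] B. Mazur, J. Tate, *The `p`-adic sigma function*, Duke Math. J. 62, Thm. 3.1. [cite: MazurTate1991, Thm. 3.1]
* [Silverman 2005] J. H. Silverman, Math. Ann. 332, §5 Rem. 2. [cite: Silverman2005DivPoly, §5 Rem. 2]
* [Mazur–Stein–Tate 2006] Doc. Math. Extra Vol., Thm. 1.3, §2.7–2.8. [cite: MazurSteinTate2006, Thm. 1.3]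
* [Serre 1973] *A Course in Arithmetic*, Ch. II §3.3 (squares in `ℚ₂`). [cite: Serre1973, Ch. II §3.3 Thm. 4]
* [Marcus] *Number Fields*, Ch. 3 Thm. 25. [cite: Marcus2018, Ch. 3 Thm. 25]
-/

noncomputable section

open PowerSeries Literature.NumberTheory.EllipticCurves

namespace WeierstrassCurve

/-! ### §1. Three polynomial identities (machine-certified cofactors) -/

section Identities

variable {R : Type*} [CommRing R]

/-- **The `2`-isogeny identity for the twists `V_d = [1, -(3d+1)/4, 0, -2d², -d³]` of `X₀(49)` at the
formal point, cleared** (`Φ_d`): with `A = X - de·z²`, `B = X² + (d²t - d²e²)z⁴`, `Ỹ = (z - 2)X`,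
`ϖ = 3 + 4e`, `Q = -(A² - d²t·z⁴)Ỹ + ϖ z A B`, the Weierstrass relation of `V_d` for `X = z²x(z)`
(times `4`), `4e² + 5e + 2 = 0` and `4t = -14 - 21e` give
`Q² = 4AB³ + 2ϖzABQ - (3d+1)ϖ²z²A²B² - 8d²ϖ⁴z⁴A³B - 4d³ϖ⁶z⁶A⁴` (times `16`; `d = 1` is the identity
of `X049CMSigmaSqTwoProofs`). Machine-generated cofactors. [cite: Velu1971, formules (7)–(11)] [folklore] -/
private theorem phi_identity_twist (X Xs e t d : R)
    (hcurve4 : 4 * Xs ^ 2 = 4 * Xs ^ 3 + 4 * X * Xs ^ 2 - (3 * d + 1) * X ^ 2 * Xs ^ 2 - 8 * d ^ 2 * X ^ 4 * Xs - 4 * d ^ 3 * X ^ 6)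
    (he : 4 * e ^ 2 + 5 * e + 2 = 0) (ht : 4 * t = -14 - 21 * e) :
    16 * ((-((Xs - (d * e) * X ^ 2) ^ 2 - (d ^ 2 * t) * X ^ 4) * ((X - 2) * Xs) + (3 + 4 * e) * X * (Xs - (d * e) * X ^ 2) * (Xs ^ 2 + ((d ^ 2 * t) - (d * e) ^ 2) * X ^ 4)) ^ 2 - (4 * (Xs - (d * e) * X ^ 2) * (Xs ^ 2 + ((d ^ 2 * t) - (d * e) ^ 2) * X ^ 4) ^ 3 + 2 * (3 + 4 * e) * X * (Xs - (d * e) * X ^ 2) * (Xs ^ 2 + ((d ^ 2 * t) - (d * e) ^ 2) * X ^ 4) * (-((Xs - (d * e) * X ^ 2) ^ 2 - (d ^ 2 * t) * X ^ 4) * ((X - 2) * Xs) + (3 + 4 * e) * X * (Xs - (d * e) * X ^ 2) * (Xs ^ 2 + ((d ^ 2 * t) - (d * e) ^ 2) * X ^ 4)) - (3 * d + 1) * (3 + 4 * e) ^ 2 * X ^ 2 * (Xs - (d * e) * X ^ 2) ^ 2 * (Xs ^ 2 + ((d ^ 2 * t) - (d * e) ^ 2) * X ^ 4) ^ 2 -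 8 * d ^ 2 * (3 + 4 * e) ^ 4 * X ^ 4 * (Xs - (d * e) * X ^ 2) ^ 3 * (Xs ^ 2 + ((d ^ 2 * t) - (d * e) ^ 2) * X ^ 4) - 4 * d ^ 3 * (3 + 4 * e) ^ 6 * X ^ 6 * (Xs - (d * e) * X ^ 2) ^ 4)) = 0 := by
  linear_combination ((16) * Xs ^ 4 + (-64) * X ^ 2 * Xs ^ 3 * e * d + (64) * X ^ 4 * Xs ^ 2 * d ^ 2 + (48) * X ^ 4 * Xs ^ 2 * e * d ^ 2 + (128) * X ^ 6 * Xs * d ^ 3 + (128) * X ^ 6 * Xs * e * d ^ 3 + (16) * X ^ 8 * d ^ 4 + (64) * X ^ 8 * e * d ^ 4) * hcurve4 + ((192) * X ^ 2 * Xs ^ 6 * d + (96) * X ^ 4 * Xs ^ 4 * d ^ 2 + (5584) * X ^ 4 * Xs ^ 5 * d ^ 2 + (13952) * X ^ 4 * Xs ^ 5 * e * d ^ 2 + (8192) * X ^ 4 * Xs ^ 5 * e ^ 2 * d ^ 2 + (-96) * X ^ 5 * Xs ^ 4 * d ^ 2 + (-256) * X ^ 6 * Xs ^ 3 * d ^ 3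 + (-64) * X ^ 6 * Xs ^ 3 * e * d ^ 3 + (24) * X ^ 6 * Xs ^ 4 * d ^ 2 + (21944) * X ^ 6 * Xs ^ 4 * d ^ 3 + (110016) * X ^ 6 * Xs ^ 4 * e * d ^ 3 + (210752) * X ^ 6 * Xs ^ 4 * e ^ 2 * d ^ 3 + (188416) * X ^ 6 * Xs ^ 4 * e ^ 3 * d ^ 3 + (65536) * X ^ 6 * Xs ^ 4 * e ^ 4 * d ^ 3 + (256) * X ^ 7 * Xs ^ 3 * d ^ 3 + (64) * X ^ 7 * Xs ^ 3 * e * d ^ 3 + (360) * X ^ 8 * Xs ^ 2 * d ^ 4 + (148) * X ^ 8 * Xs ^ 2 * e * d ^ 4 + (16) * X ^ 8 * Xs ^ 2 * e ^ 2 * d ^ 4 + (-64) * X ^ 8 * Xs ^ 3 * d ^ 3 + (-19736) * X ^ 8 * Xs ^ 3 * d ^ 4 + (-16) * X ^ 8 * Xs ^ 3 * e * d ^ 3 + (-168588) * X ^ 8 * Xs ^ 3 * e * d ^ 4 + (-604592) * X ^ 8 * Xs ^ 3 * e ^ 2 * d ^ 4 + (-1029376) * X ^ 8 * Xs ^ 3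 * e ^ 3 * d ^ 4 + (-835584) * X ^ 8 * Xs ^ 3 * e ^ 4 * d ^ 4 + (-262144) * X ^ 8 * Xs ^ 3 * e ^ 5 * d ^ 4 + (-360) * X ^ 9 * Xs ^ 2 * d ^ 4 + (-148) * X ^ 9 * Xs ^ 2 * e * d ^ 4 + (-16) * X ^ 9 * Xs ^ 2 * e ^ 2 * d ^ 4 + (90) * X ^ 10 * Xs ^ 2 * d ^ 4 + (1982) * X ^ 10 * Xs ^ 2 * d ^ 5 + (37) * X ^ 10 * Xs ^ 2 * e * d ^ 4 + (64943) * X ^ 10 * Xs ^ 2 * e * d ^ 5 + (4) * X ^ 10 * Xs ^ 2 * e ^ 2 * d ^ 4 + (380952) * X ^ 10 * Xs ^ 2 * e ^ 2 * d ^ 5 + (1097216) * X ^ 10 * Xs ^ 2 * e ^ 3 * d ^ 5 + (1681216) * X ^ 10 * Xs ^ 2 * e ^ 4 * d ^ 5 + (1294336) * X ^ 10 * Xs ^ 2 * e ^ 5 * d ^ 5 + (393216) * X ^ 10 * Xs ^ 2 * e ^ 6 * d ^ 5 + (1052) * X ^ 12 * Xs * d ^ 6 + (-2260) * X ^ 12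 * Xs * e * d ^ 6 + (-70437) * X ^ 12 * Xs * e ^ 2 * d ^ 6 + (-343168) * X ^ 12 * Xs * e ^ 3 * d ^ 6 + (-848912) * X ^ 12 * Xs * e ^ 4 * d ^ 6 + (-1188224) * X ^ 12 * Xs * e ^ 5 * d ^ 6 + (-876544) * X ^ 12 * Xs * e ^ 6 * d ^ 6 + (-262144) * X ^ 12 * Xs * e ^ 7 * d ^ 6 + (-32) * X ^ 14 * d ^ 7 + (-1420) * X ^ 14 * e * d ^ 7 + (86) * X ^ 14 * e ^ 2 * d ^ 7 + (25326) * X ^ 14 * e ^ 3 * d ^ 7 + (109004) * X ^ 14 * e ^ 4 * d ^ 7 + (240640) * X ^ 14 * e ^ 5 * d ^ 7 + (311488) * X ^ 14 * e ^ 6 * d ^ 7 + (221184) * X ^ 14 * e ^ 7 * d ^ 7 + (65536) * X ^ 14 * e ^ 8 * d ^ 7) * he + ((-32) * X ^ 4 * Xs ^ 4 * d ^ 2 + (-48) * X ^ 4 * Xs ^ 5 * d ^ 2 + (32) * X ^ 5 * Xs ^ 4 * d ^ 2 + (64) * X ^ 6 * Xs ^ 3 * e * d ^ 3 + (-8) *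 X ^ 6 * Xs ^ 4 * d ^ 2 + (216) * X ^ 6 * Xs ^ 4 * d ^ 3 + (624) * X ^ 6 * Xs ^ 4 * e * d ^ 3 + (384) * X ^ 6 * Xs ^ 4 * e ^ 2 * d ^ 3 + (-64) * X ^ 7 * Xs ^ 3 * e * d ^ 3 + (-56) * X ^ 8 * Xs ^ 2 * d ^ 4 + (16) * X ^ 8 * Xs ^ 2 * t * d ^ 4 + (-84) * X ^ 8 * Xs ^ 2 * e * d ^ 4 + (-32) * X ^ 8 * Xs ^ 2 * e ^ 2 * d ^ 4 + (2760) * X ^ 8 * Xs ^ 3 * d ^ 4 + (-48) * X ^ 8 * Xs ^ 3 * t * d ^ 4 + (16) * X ^ 8 * Xs ^ 3 * e * d ^ 3 + (13644) * X ^ 8 * Xs ^ 3 * e * d ^ 4 + (26592) * X ^ 8 * Xs ^ 3 * e ^ 2 * d ^ 4 + (23808) * X ^ 8 * Xs ^ 3 * e ^ 3 * d ^ 4 + (8192) * X ^ 8 * Xs ^ 3 * e ^ 4 * d ^ 4 + (56) * X ^ 9 * Xs ^ 2 * d ^ 4 + (-16) * X ^ 9 * Xs ^ 2 * t * d ^ 4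 + (84) * X ^ 9 * Xs ^ 2 * e * d ^ 4 + (32) * X ^ 9 * Xs ^ 2 * e ^ 2 * d ^ 4 + (-14) * X ^ 10 * Xs ^ 2 * d ^ 4 + (-378) * X ^ 10 * Xs ^ 2 * d ^ 5 + (4) * X ^ 10 * Xs ^ 2 * t * d ^ 4 + (108) * X ^ 10 * Xs ^ 2 * t * d ^ 5 + (-21) * X ^ 10 * Xs ^ 2 * e * d ^ 4 + (-9519) * X ^ 10 * Xs ^ 2 * e * d ^ 5 + (336) * X ^ 10 * Xs ^ 2 * e * t * d ^ 5 + (-8) * X ^ 10 * Xs ^ 2 * e ^ 2 * d ^ 4 + (-43908) * X ^ 10 * Xs ^ 2 * e ^ 2 * d ^ 5 + (192) * X ^ 10 * Xs ^ 2 * e ^ 2 * t * d ^ 5 + (-84048) * X ^ 10 * Xs ^ 2 * e ^ 3 * d ^ 5 + (-73728) * X ^ 10 * Xs ^ 2 * e ^ 4 * d ^ 5 + (-24576) * X ^ 10 * Xs ^ 2 * e ^ 5 * d ^ 5 + (-196) * X ^ 12 * Xs * d ^ 6 + (56) * X ^ 12 * Xs * t * d ^ 6 + (-16) * X ^ 12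 * Xs * t ^ 2 * d ^ 6 + (168) * X ^ 12 * Xs * e * d ^ 6 + (-132) * X ^ 12 * Xs * e * t * d ^ 6 + (10317) * X ^ 12 * Xs * e ^ 2 * d ^ 6 + (-528) * X ^ 12 * Xs * e ^ 2 * t * d ^ 6 + (46020) * X ^ 12 * Xs * e ^ 3 * d ^ 6 + (-384) * X ^ 12 * Xs * e ^ 3 * t * d ^ 6 + (86064) * X ^ 12 * Xs * e ^ 4 * d ^ 6 + (74496) * X ^ 12 * Xs * e ^ 5 * d ^ 6 + (24576) * X ^ 12 * Xs * e ^ 6 * d ^ 6 + (196) * X ^ 14 * e * d ^ 7 + (-56) * X ^ 14 * e * t * d ^ 7 + (16) * X ^ 14 * e * t ^ 2 * d ^ 7 + (210) * X ^ 14 * e ^ 2 * d ^ 7 + (24) * X ^ 14 * e ^ 2 * t * d ^ 7 + (-3558) * X ^ 14 * e ^ 3 * d ^ 7 + (240) * X ^ 14 * e ^ 3 * t * d ^ 7 + (-15972) * X ^ 14 * e ^ 4 * d ^ 7 + (192) * X ^ 14 * e ^ 4 * t * d ^ 7 + (-29184) * X ^ 14 * e ^ 5 * d ^ 7 + (-24960)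 * X ^ 14 * e ^ 6 * d ^ 7 + (-8192) * X ^ 14 * e ^ 7 * d ^ 7) * ht

/-- **The cleared Weierstrass equation of the image point** (`heq` of the chart-uniqueness lemma)
for `τ = 2ϖzABq`, `P = 4AB³q²`, `Qq = 1`, from `Φ_d` — with `A`, `B`, `Q`, `ϖ`, `d` and the
`a`-invariants `a₂ = -(3d+1)/4`, `a₄ = -2d²`, `a₆ = -d³` as atoms. [folklore] -/
private theorem heq_identity_twist (X A B Q q w d a₂ a₄ a₆ : R)
    (hΦ : Q ^ 2 = 4 * A * B ^ 3 + 2 * w * X * A * B * Q - (3 * d + 1) * w ^ 2 * X ^ 2 * A ^ 2 * B ^ 2 - 8 * d ^ 2 * w ^ 4 * X ^ 4 * A ^ 3 * B - 4 * d ^ 3 * w ^ 6 * X ^ 6 * A ^ 4)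
    (hq : Q * q = 1) (ha₂ : 4 * a₂ = -(3 * d + 1)) (ha₄ : a₄ = -2 * d ^ 2) (ha₆ : a₆ = -d ^ 3) :
    (4 * A * B ^ 3 * q ^ 2) ^ 2 = (4 * A * B ^ 3 * q ^ 2) ^ 3 + (2 * w * X * A * B * q) * (4 * A * B ^ 3 * q ^ 2) ^ 2 + a₂ * (2 * w * X * A * B * q) ^ 2 * (4 * A * B ^ 3 * q ^ 2) ^ 2 +
      a₄ * (2 * w * X * A * B * q) ^ 4 * (4 * A * B ^ 3 * q ^ 2) + a₆ * (2 * w * X * A * B * q) ^ 6 := by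
  have hs : 1 = 4 * A * B ^ 3 * q ^ 2 + 2 * w * X * A * B * q - (3 * d + 1) * w ^ 2 * X ^ 2 * A ^ 2 * B ^ 2 * q ^ 2 -
      8 * d ^ 2 * w ^ 4 * X ^ 4 * A ^ 3 * B * q ^ 2 - 4 * d ^ 3 * w ^ 6 * X ^ 6 * A ^ 4 * q ^ 2 := by
    linear_combination q ^ 2 * hΦ + (2 * w * X * A * B * q - (Q * q + 1)) * hq
  linear_combination (16 * A ^ 2 * B ^ 6 * q ^ 4) * hs -
    (16 * A ^ 2 * B ^ 6 * q ^ 4 * w ^ 2 * X ^ 2 * A ^ 2 * B ^ 2 * q ^ 2) * ha₂ -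
    (64 * A ^ 2 * B ^ 6 * q ^ 4 * w ^ 4 * X ^ 4 * A ^ 3 * B * q ^ 2) * ha₄ -
    (64 * A ^ 2 * B ^ 6 * q ^ 4 * w ^ 6 * X ^ 6 * A ^ 4 * q ^ 2) * ha₆

/-- **The chain rule `ξ' = R'(x)x'` for the `x`-coordinate `ξ = P/τ²` of the image point**, in the
form `(τP' - 2Pτ')·Ỹ = ϖ(zX' - 2X)·(τ - 2)P` (`d = X'`, `dq = q'`), with the `2`-torsion abscissa `E`,
Vélu's constant `T` and the multiplier `ϖ = w` as free atoms (`A = X - Ez²`, `B = X² + (T - E²)z⁴`,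
`Q = -(A² - Tz⁴)Ỹ + wzAB`, `Qq = 1`). [folklore] -/
private theorem star_identity_twist (X Xs E T w q d dq : R)
    (hq : (-((Xs - E * X ^ 2) ^ 2 - T * X ^ 4) * ((X - 2) * Xs) + w * X * (Xs - E * X ^ 2) * (Xs ^ 2 + (T - E ^ 2) * X ^ 4)) * q = 1) :
    ((2 * w * X * (Xs - E * X ^ 2) * (Xs ^ 2 + (T - E ^ 2) * X ^ 4) * q) * (4 * ((d - 2 * E * X) * (Xs ^ 2 + (T - E ^ 2) * X ^ 4) ^ 3 * q ^ 2 + 3 * (Xs - E * X ^ 2) * (Xs ^ 2 + (T - E ^ 2) * X ^ 4) ^ 2 * (2 * Xs * d + 4 * (T - E ^ 2) * X ^ 3) * q ^ 2 + 2 * (Xs - E * X ^ 2) * (Xs ^ 2 + (T - E ^ 2) * X ^ 4) ^ 3 * q * dq)) - 2 * (4 * (Xs - E * X ^ 2) * (Xs ^ 2 + (T - E ^ 2) * X ^ 4) ^ 3 * q ^ 2) * (2 * w * ((Xs - E * X ^ 2) * (Xs ^ 2 + (T - E ^ 2) * X ^ 4) * q + X * ((d - 2 * E * X) * (Xs ^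 2 + (T - E ^ 2) * X ^ 4) * q + (Xs - E * X ^ 2) * (2 * Xs * d + 4 * (T - E ^ 2) * X ^ 3) * q + (Xs - E * X ^ 2) * (Xs ^ 2 + (T - E ^ 2) * X ^ 4) * dq)))) * ((X - 2) * Xs) =
      w * (X * d - 2 * Xs) * (((2 * w * X * (Xs - E * X ^ 2) * (Xs ^ 2 + (T - E ^ 2) * X ^ 4) * q) - 2) * (4 * (Xs - E * X ^ 2) * (Xs ^ 2 + (T - E ^ 2) * X ^ 4) ^ 3 * q ^ 2)) := by
  linear_combination ((16) * Xs ^ 8 * w * q ^ 2 + (-8) * X * Xs ^ 7 * w * q ^ 2 * d + (-16) * X ^ 2 * Xs ^ 7 * E * w * q ^ 2 + (8) * X ^ 3 * Xs ^ 6 * E * w * q ^ 2 * d + (48) * X ^ 4 * Xs ^ 6 * T * w * q ^ 2 + (-48) * X ^ 4 * Xs ^ 6 * E ^ 2 * w * q ^ 2 + (-24) * X ^ 5 * Xs ^ 5 * T * w * q ^ 2 * d + (24) * X ^ 5 * Xs ^ 5 * E ^ 2 * w * q ^ 2 * d + (-48) * X ^ 6 * Xs ^ 5 * E * T * w * q ^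 2 + (48) * X ^ 6 * Xs ^ 5 * E ^ 3 * w * q ^ 2 + (24) * X ^ 7 * Xs ^ 4 * E * T * w * q ^ 2 * d + (-24) * X ^ 7 * Xs ^ 4 * E ^ 3 * w * q ^ 2 * d + (48) * X ^ 8 * Xs ^ 4 * T ^ 2 * w * q ^ 2 + (-96) * X ^ 8 * Xs ^ 4 * E ^ 2 * T * w * q ^ 2 + (48) * X ^ 8 * Xs ^ 4 * E ^ 4 * w * q ^ 2 + (-24) * X ^ 9 * Xs ^ 3 * T ^ 2 * w * q ^ 2 * d + (48) * X ^ 9 * Xs ^ 3 * E ^ 2 * T * w * q ^ 2 * d + (-24) * X ^ 9 * Xs ^ 3 * E ^ 4 * w * q ^ 2 * d + (-48) * X ^ 10 * Xs ^ 3 * E * T ^ 2 * w * q ^ 2 + (96) * X ^ 10 * Xs ^ 3 * E ^ 3 * T * w * q ^ 2 + (-48) * X ^ 10 * Xs ^ 3 * E ^ 5 * w * q ^ 2 + (24) * X ^ 11 * Xs ^ 2 * E * T ^ 2 * w * q ^ 2 * d + (-48) * X ^ 11 * Xs ^ 2 * E ^ 3 * T * w * q ^ 2 * d + (24) * X ^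 11 * Xs ^ 2 * E ^ 5 * w * q ^ 2 * d + (16) * X ^ 12 * Xs ^ 2 * T ^ 3 * w * q ^ 2 + (-48) * X ^ 12 * Xs ^ 2 * E ^ 2 * T ^ 2 * w * q ^ 2 + (48) * X ^ 12 * Xs ^ 2 * E ^ 4 * T * w * q ^ 2 + (-16) * X ^ 12 * Xs ^ 2 * E ^ 6 * w * q ^ 2 + (-8) * X ^ 13 * Xs * T ^ 3 * w * q ^ 2 * d + (24) * X ^ 13 * Xs * E ^ 2 * T ^ 2 * w * q ^ 2 * d + (-24) * X ^ 13 * Xs * E ^ 4 * T * w * q ^ 2 * d + (8) * X ^ 13 * Xs * E ^ 6 * w * q ^ 2 * d + (-16) * X ^ 14 * Xs * E * T ^ 3 * w * q ^ 2 + (48) * X ^ 14 * Xs * E ^ 3 * T ^ 2 * w * q ^ 2 + (-48) * X ^ 14 * Xs * E ^ 5 * T * w * q ^ 2 + (16) * X ^ 14 * Xs * E ^ 7 * w * q ^ 2 + (8) * X ^ 15 * E * T ^ 3 * w * q ^ 2 * d + (-24) * X ^ 15 * E ^ 3 * T ^ 2 * w * q ^ 2 * d + (24) * X ^ 15 * E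 ^ 5 * T * w * q ^ 2 * d + (-8) * X ^ 15 * E ^ 7 * w * q ^ 2 * d) * hq

end Identities

/-! ### §2. The CM `2`-isogeny datum of the twists `V_d` over `ℚ_p` -/

section Datum

variable {p : ℕ} [Fact p.Prime]

/-- If `log_W(T) = ϖ·log_W` then `T = exp_W(ϖ·log_W) = [ϖ]`, hence `T ∈ ℤ_p⟦z⟧` for `ϖ ∈ ℤ_p`.
[cite: SilvermanAEC2009, IV.5] [folklore] -/
private theorem isPadicInt_of_formalLog_subst_eq' (V : WeierstrassCurve ℚ_[p]) [V.IsIntegral ℤ_[p]]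
    {T : ℚ_[p]⟦X⟧} {ϖ : ℚ_[p]} (hT0 : constantCoeff T = 0)
    (hlog : V.formalLog.subst T = C ϖ * V.formalLog) (hϖ : ‖ϖ‖ ≤ 1) : IsPadicInt T := by
  have hs : HasSubst T := HasSubst.of_constantCoeff_zero' hT0
  have hT : T = V.formalExp.subst (C ϖ * V.formalLog) := by
    have e1 := subst_comp_subst_apply (HasSubst.of_constantCoeff_zero' V.constantCoeff_formalLog) hs V.formalExp
    rw [V.formalExp_subst_formalLog, subst_X hs, hlog] at e1
    exact e1
  rw [hT]
  exact V.isPadicInt_formalExp_subst_C_mul_formalLog hϖ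

set_option maxHeartbeats 1600000 in
/-- **The CM `2`-isogeny datum of the twist `V_d = [1, -(3d+1)/4, 0, -2d², -d³]` of `X₀(49)` over
`ℚ_p`** (any `d ∈ ℚ_p`; any prime `p` at which the étale `2`-torsion abscissa of `49a1` is `p`-adic,
i.e. a root `e ∈ ℚ_p` of `4e² + 5e + 2`): `V_d` is the quadratic twist of `49a1 = [1,-1,0,-2,-1]` by
`d` (`b`-invariants `(-3d, -4d², -4d³)`; `V_1 = 49a1`), its `2`-torsion abscissa in the kernel of
`[ϖ]`, `ϖ = 3 + 4e = (1 ± √-7)/2`, is `e_d = d·e`, Vélu's constant is `t_d = d²t`, `t = -(14 + 21e)/4`,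
and there is `T ∈ zℚ_p⟦z⟧` with `log_{V_d}(T) = ϖ·log_{V_d}` (so `T = [ϖ]`, the complex multiplication
by `(1 ± √-7)/2` of the CM curve `V_d`, read on its formal group) and
`ϖ²·x(T) = x + t_d/(x - e_d) + e_d` (Vélu's `2`-isogeny with kernel `{O, (e_d, -e_d/2)}` composed with
the isomorphism `u = ϖ⁻¹, r = e_dϖ⁻²` back to `V_d`). Construction and verification exactly as for
`d = 1` (`cm7_exists_cmTwoIsogenyDatum`): `T = 2ϖzAB/Q`, `X(T) = 4AB³/Q²` with `A = X - e_d z²`,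
`B = X² + (t_d - e_d²)z⁴`, `Q = -(A² - t_d z⁴)Ỹ + ϖzAB`, checked against the Weierstrass equation by
`phi_identity_twist` / `heq_identity_twist`, the uniqueness of the formal chart
(`formalXMulSq_subst_eq_of_sq_eq`) and the chain rule (`star_identity_twist`, `formalEta_subst_mul_eq`):
`ω(T)·T' = ϖ·ω ⟹ log(T) = ϖ·log`. The hypotheses name `V_d` by its `a`-invariants (`4a₂ = -(3d+1)`),
so any `ℚ_p`-model with these invariants qualifies. [Vélu 1971; Silverman AEC III.4, IV.1;
Perrin-Riou 1984, Ch. III §1.2] [cite: Perrinriou1984, Ch. III §1.2] [cite: Velu1971, formules (7)–(11)] -/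
theorem twist_exists_cmTwoIsogenyDatum (V : WeierstrassCurve ℚ_[p]) {d e : ℚ_[p]} (ha₁ : V.a₁ = 1)
    (ha₂ : 4 * V.a₂ = -(3 * d + 1)) (ha₃ : V.a₃ = 0) (ha₄ : V.a₄ = -2 * d ^ 2) (ha₆ : V.a₆ = -d ^ 3)
    (he : 4 * e ^ 2 + 5 * e + 2 = 0) :
    ∃ T : ℚ_[p]⟦X⟧, constantCoeff T = 0 ∧
      V.formalLog.subst T = C (3 + 4 * e) * V.formalLog ∧
      C (3 + 4 * e) ^ 2 * V.formalXMulSq.subst T * (X ^ 2 * (V.formalXMulSq - C (d * e) * X ^ 2)) =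
        T ^ 2 * (V.formalXMulSq * (V.formalXMulSq - C (d * e) * X ^ 2) +
          C (d ^ 2 * (-(14 + 21 * e) / 4)) * X ^ 4 +
          C (d * e) * X ^ 2 * (V.formalXMulSq - C (d * e) * X ^ 2)) := by
  set t : ℚ_[p] := -(14 + 21 * e) / 4 with ht_def
  set Xs := V.formalXMulSq with hXs
  -- constants at the level of power series
  have heC : 4 * (C e : ℚ_[p]⟦X⟧) ^ 2 + 5 * C e + 2 = 0 := by
    have := congrArg (C (R := ℚ_[p])) he
    simpa only [map_add, map_mul, map_pow, map_ofNat, map_zero] using this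
  have htC : 4 * (C t : ℚ_[p]⟦X⟧) = -14 - 21 * C e := by
    have h4 : 4 * t = -14 - 21 * e := by rw [ht_def]; ring
    have := congrArg (C (R := ℚ_[p])) h4
    simpa only [map_sub, map_mul, map_ofNat, map_neg] using this
  have hϖC : (C (3 + 4 * e) : ℚ_[p]⟦X⟧) = 3 + 4 * C e := by
    simp only [map_add, map_mul, map_ofNat]
  have hdeC : (C (d * e) : ℚ_[p]⟦X⟧) = C d * C e := map_mul C d e
  have hdtC : (C (d ^ 2 * t) : ℚ_[p]⟦X⟧) = C d ^ 2 * C t := by rw [map_mul, map_pow]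
  have ha₂C : 4 * (C V.a₂ : ℚ_[p]⟦X⟧) = -(3 * C d + 1) := by
    have := congrArg (C (R := ℚ_[p])) ha₂
    simpa only [map_mul, map_ofNat, map_neg, map_add, map_one] using this
  have ha₄C : (C V.a₄ : ℚ_[p]⟦X⟧) = -2 * C d ^ 2 := by
    rw [ha₄]; simp only [map_mul, map_neg, map_ofNat, map_pow]
  have ha₆C : (C V.a₆ : ℚ_[p]⟦X⟧) = -C d ^ 3 := by
    rw [ha₆]; simp only [map_neg, map_pow]
  -- the Weierstrass relation of `X = z²x`, times `4`
  have hcurve4 : 4 * Xs ^ 2 = 4 * Xs ^ 3 + 4 * X * Xs ^ 2 - (3 * C d + 1) * X ^ 2 * Xs ^ 2 -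
      8 * C d ^ 2 * X ^ 4 * Xs - 4 * C d ^ 3 * X ^ 6 := by
    have h := V.formalXMulSq_sq_eq
    rw [ha₁, ha₃] at h
    simp only [map_one, map_zero, one_mul, zero_mul, add_zero] at h
    rw [← hXs] at h
    linear_combination 4 * h + (X ^ 2 * Xs ^ 2) * ha₂C + (4 * X ^ 4 * Xs) * ha₄C + (4 * X ^ 6) * ha₆C
  have hXs0 : constantCoeff Xs = 1 := by rw [hXs]; exact V.constantCoeff_formalXMulSq
  -- `Φ_d`
  have hΦ16 := phi_identity_twist X Xs (C e) (C t) (C d) hcurve4 heC htC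
  have h16 : (16 : ℚ_[p]⟦X⟧) ≠ 0 := by
    rw [show (16 : ℚ_[p]⟦X⟧) = C (16 : ℚ_[p]) by simp [map_ofNat]]
    exact fun h => by
      have := C_injective (h.trans (map_zero C).symm)
      norm_num at this
  have hΦ : (-((Xs - (C d * C e) * X ^ 2) ^ 2 - (C d ^ 2 * C t) * X ^ 4) * ((X - 2) * Xs) + (3 + 4 * C e) * X * (Xs - (C d * C e) * X ^ 2) * (Xs ^ 2 + ((C d ^ 2 * C t) - (C d * C e) ^ 2) * X ^ 4)) ^ 2 = 4 * (Xs - (C d * C e) * X ^ 2) * (Xs ^ 2 + ((C d ^ 2 * C t) - (C d * C e) ^ 2) * X ^ 4) ^ 3 + 2 * (3 + 4 * C e) * X * (Xs - (C d * C e) * X ^ 2) * (Xs ^ 2 + ((C d ^ 2 * C t) - (C d * C e) ^ 2) * X ^ 4) * (-((Xs - (C d * C e) * X ^ 2) ^ 2 - (C d ^ 2 * C t) * X ^ 4) * ((X - 2) * Xs) + (3 + 4 * C e) * X * (Xs - (C d * C e) * X ^ 2) * (Xs ^ 2 + ((C d ^ 2 * C t) - (C d * C e) ^ 2) * X ^ 4))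 - (3 * C d + 1) * (3 + 4 * C e) ^ 2 * X ^ 2 * (Xs - (C d * C e) * X ^ 2) ^ 2 * (Xs ^ 2 + ((C d ^ 2 * C t) - (C d * C e) ^ 2) * X ^ 4) ^ 2 - 8 * C d ^ 2 * (3 + 4 * C e) ^ 4 * X ^ 4 * (Xs - (C d * C e) * X ^ 2) ^ 3 * (Xs ^ 2 + ((C d ^ 2 * C t) - (C d * C e) ^ 2) * X ^ 4) - 4 * C d ^ 3 * (3 + 4 * C e) ^ 6 * X ^ 6 * (Xs - (C d * C e) * X ^ 2) ^ 4 := sub_eq_zero.mp ((mul_eq_zero.mp hΦ16).resolve_left h16)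
  -- `Q` is invertible: `Q(0) = 2`
  have hQ0 : constantCoeff (-((Xs - (C d * C e) * X ^ 2) ^ 2 - (C d ^ 2 * C t) * X ^ 4) * ((X - 2) * Xs) + (3 + 4 * C e) * X * (Xs - (C d * C e) * X ^ 2) * (Xs ^ 2 + ((C d ^ 2 * C t) - (C d * C e) ^ 2) * X ^ 4)) = 2 := by
    simp only [map_add, map_sub, map_mul, map_pow, map_neg, constantCoeff_C, constantCoeff_X, hXs0,
      map_ofNat]
    norm_num
  have h2 : (2 : ℚ_[p]) ≠ 0 := two_ne_zero
  set iQ := invOfUnit (-((Xs - (C d * C e) * X ^ 2) ^ 2 - (C d ^ 2 * C t) * X ^ 4) * ((X - 2) * Xs) + (3 + 4 * C e) * X * (Xs - (C d * C e) * X ^ 2) * (Xs ^ 2 + ((C d ^ 2 * C t) - (C d * C e) ^ 2) * X ^ 4)) (Units.mk0 (2 : ℚ_[p]) h2) with hiQ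
  have hQi : (-((Xs - (C d * C e) * X ^ 2) ^ 2 - (C d ^ 2 * C t) * X ^ 4) * ((X - 2) * Xs) + (3 + 4 * C e) * X * (Xs - (C d * C e) * X ^ 2) * (Xs ^ 2 + ((C d ^ 2 * C t) - (C d * C e) ^ 2) * X ^ 4)) * iQ = 1 := mul_invOfUnit _ _ (by rw [hQ0, Units.val_mk0])
  have hiQ0 : constantCoeff iQ = 2⁻¹ := by
    rw [hiQ, constantCoeff_invOfUnit, Units.val_inv_eq_inv_val, Units.val_mk0]
  clear_value iQ
  -- the parameter `τ = 2ϖzAB/Q` of the image point and `P = X(τ) = 4AB³/Q²`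
  set τ := (2 * (3 + 4 * C e) * X * (Xs - (C d * C e) * X ^ 2) * (Xs ^ 2 + ((C d ^ 2 * C t) - (C d * C e) ^ 2) * X ^ 4) * iQ) with hτ
  set P := (4 * (Xs - (C d * C e) * X ^ 2) * (Xs ^ 2 + ((C d ^ 2 * C t) - (C d * C e) ^ 2) * X ^ 4) ^ 3 * iQ ^ 2) with hP
  have hτ0 : constantCoeff τ = 0 := by
    rw [hτ]; simp only [map_mul, constantCoeff_X, mul_zero, zero_mul]
  have hP0 : constantCoeff P = 1 := by
    rw [hP]
    simp only [map_mul, map_pow, map_add, map_sub, constantCoeff_C, constantCoeff_X, hXs0, hiQ0,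
      map_ofNat]
    norm_num
  clear_value τ P
  -- `heq` and the chart: `X(τ) = P`
  have heq := heq_identity_twist X (Xs - (C d * C e) * X ^ 2) (Xs ^ 2 + ((C d ^ 2 * C t) - (C d * C e) ^ 2) * X ^ 4) (-((Xs - (C d * C e) * X ^ 2) ^ 2 - (C d ^ 2 * C t) * X ^ 4) * ((X - 2) * Xs) + (3 + 4 * C e) * X * (Xs - (C d * C e) * X ^ 2) * (Xs ^ 2 + ((C d ^ 2 * C t) - (C d * C e) ^ 2) * X ^ 4)) iQ (3 + 4 * C e) (C d) (C V.a₂) (C V.a₄) (C V.a₆) hΦ hQi ha₂C ha₄C ha₆C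
  rw [← hτ, ← hP] at heq
  have heq' : P ^ 2 = P ^ 3 + C V.a₁ * τ * P ^ 2 + C V.a₂ * τ ^ 2 * P ^ 2 + C V.a₃ * τ ^ 3 * P +
      C V.a₄ * τ ^ 4 * P + C V.a₆ * τ ^ 6 := by
    rw [ha₁, ha₃]
    simp only [map_one, map_zero, one_mul, zero_mul, add_zero]
    exact heq
  have hXP : Xs.subst τ = P := by rw [hXs]; exact V.formalXMulSq_subst_eq_of_sq_eq hτ0 hP0 heq'
  -- the invariant differential along `τ`: `ϖ·η(τ) = τ'·η`
  have hchart := V.formalEta_subst_mul_eq hτ0 hP0 heq'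
  rw [ha₁, ha₃] at hchart
  simp only [map_one, map_zero, one_mul, zero_mul, add_zero] at hchart
  set DXs := d⁄dX ℚ_[p] Xs with hDXs
  set DiQ := d⁄dX ℚ_[p] iQ with hDiQ
  have hD2 : d⁄dX ℚ_[p] (2 : ℚ_[p]⟦X⟧) = 0 := Derivation.map_natCast _ 2
  have hD3 : d⁄dX ℚ_[p] (3 : ℚ_[p]⟦X⟧) = 0 := Derivation.map_natCast _ 3
  have hD4 : d⁄dX ℚ_[p] (4 : ℚ_[p]⟦X⟧) = 0 := Derivation.map_natCast _ 4
  have hdτ : d⁄dX ℚ_[p] τ = (2 * (3 + 4 * C e) * ((Xs - (C d * C e) * X ^ 2) * (Xs ^ 2 + ((C d ^ 2 * C t) - (C d * C e) ^ 2) * X ^ 4) * iQ + X * ((DXs - 2 * (C d * C e) * X) * (Xs ^ 2 + ((C d ^ 2 * C t) - (C d * C e) ^ 2) * X ^ 4) * iQ + (Xs - (C d * C e) * X ^ 2) * (2 * Xs * DXs + 4 * ((C d ^ 2 * C t) - (C d * C e) ^ 2) * X ^ 3) * iQ + (Xs - (C d * C e) * X ^ 2) * (Xs ^ 2 + ((C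 d ^ 2 * C t) - (C d * C e) ^ 2) * X ^ 4) * DiQ))) := by
    rw [hτ]
    simp only [Derivation.leibniz, Derivation.leibniz_pow, map_add, map_sub, derivative_C,
      derivative_X, hD2, hD3, hD4, smul_eq_mul, nsmul_eq_mul, ← hDXs, ← hDiQ]
    ring
  have hdP : d⁄dX ℚ_[p] P = (4 * ((DXs - 2 * (C d * C e) * X) * (Xs ^ 2 + ((C d ^ 2 * C t) - (C d * C e) ^ 2) * X ^ 4) ^ 3 * iQ ^ 2 + 3 * (Xs - (C d * C e) * X ^ 2) * (Xs ^ 2 + ((C d ^ 2 * C t) - (C d * C e) ^ 2) * X ^ 4) ^ 2 * (2 * Xs * DXs + 4 * ((C d ^ 2 * C t) - (C d * C e) ^ 2) * X ^ 3) * iQ ^ 2 + 2 * (Xs - (C d * C e) * X ^ 2) * (Xs ^ 2 + ((C d ^ 2 * C t) - (C d * C e) ^ 2) * X ^ 4) ^ 3 * iQ * DiQ)) := by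
    rw [hP]
    simp only [Derivation.leibniz, Derivation.leibniz_pow, map_add, map_sub, derivative_C,
      derivative_X, hD4, smul_eq_mul, nsmul_eq_mul, ← hDXs, ← hDiQ]
    ring
  have hstar := star_identity_twist X Xs (C d * C e) (C d ^ 2 * C t) (3 + 4 * C e) iQ DXs DiQ hQi
  rw [← hdτ, ← hdP, ← hτ, ← hP] at hstar
  have hYt : V.formalEta * (X * DXs - 2 * Xs) = (X - 2) * Xs := by
    have h := V.formalEta_mul_sub_eq_formalYTilde
    rw [formalYTilde_def, ha₁, ha₃] at h
    simp only [map_one, map_zero, one_mul, zero_mul, add_zero] at h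
    rw [← hXs, ← hDXs] at h
    exact h
  have hkey : (τ - 2) * P * (X * DXs - 2 * Xs) *
      ((3 + 4 * C e) * V.formalEta.subst τ - d⁄dX ℚ_[p] τ * V.formalEta) = 0 := by
    linear_combination (-(V.formalEta.subst τ)) * hstar + ((X - 2) * Xs) * hchart -
      (d⁄dX ℚ_[p] τ * ((τ - 2) * P)) * hYt
  have hne1 : (τ - 2) * P ≠ 0 := by
    intro h
    have := congrArg constantCoeff h
    rw [map_mul, map_sub, hτ0, hP0, map_ofNat, map_zero] at this
    norm_num at this
  have hne2 : X * DXs - 2 * Xs ≠ 0 := by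
    intro h
    have := congrArg constantCoeff h
    rw [map_sub, map_mul, constantCoeff_X, zero_mul, map_mul, map_ofNat, hXs, constantCoeff_formalXMulSq,
      map_zero] at this
    norm_num at this
  have hηη : (3 + 4 * C e) * V.formalEta.subst τ = d⁄dX ℚ_[p] τ * V.formalEta :=
    sub_eq_zero.mp ((mul_eq_zero.mp hkey).resolve_left (mul_ne_zero hne1 hne2))
  -- `ω(τ)·τ' = ϖ·ω`
  have hsτ : HasSubst τ := HasSubst.of_constantCoeff_zero' hτ0
  have hηω : V.formalEta * V.formalOmega = 1 := V.formalEta_mul_formalOmega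
  have hηωτ : V.formalEta.subst τ * V.formalOmega.subst τ = 1 := by
    rw [← subst_mul hsτ, hηω, ← coe_substAlgHom hsτ, map_one]
  have hω : V.formalOmega.subst τ * d⁄dX ℚ_[p] τ = C (3 + 4 * e) * V.formalOmega := by
    rw [hϖC]
    linear_combination (V.formalOmega * V.formalOmega.subst τ) * hηη.symm +
      ((3 + 4 * C e) * V.formalOmega) * hηωτ - (d⁄dX ℚ_[p] τ * V.formalOmega.subst τ) * hηω
  -- `log_W(τ) = ϖ·log_W`
  haveI : IsAddTorsionFree ℚ_[p]⟦X⟧ := IsAddTorsionFree.of_module_rat (M := ℚ_[p]⟦X⟧)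
  have hlog : V.formalLog.subst τ = C (3 + 4 * e) * V.formalLog := by
    have hR : d⁄dX ℚ_[p] (C (3 + 4 * e) * V.formalLog) = C (3 + 4 * e) * V.formalOmega := by
      rw [Derivation.leibniz, derivative_C, smul_zero, add_zero, smul_eq_mul, derivative_formalLog]
    refine derivative.ext ?_ ?_
    · rw [derivative_subst ℚ_[p] hsτ, derivative_formalLog, hR]
      exact hω
    · rw [Literature.RingTheory.FormalGroups.constantCoeff_subst_of_constantCoeff_eq_zero hτ0, map_mul,
        V.constantCoeff_formalLog, mul_zero]
  refine ⟨τ, hτ0, hlog, ?_⟩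
  -- the `x`-relation
  rw [hXP, hP, hτ]
  have htC' : (C (d ^ 2 * (-(14 + 21 * e) / 4)) : ℚ_[p]⟦X⟧) = C d ^ 2 * C t := by rw [← hdtC]
  rw [htC', hdeC, hϖC]
  ring

end Datum

/-! ### §3. At `p = 2`: `(σ², 0)` is THE Mazur–Tate sigma-squared pair of `V_d ⊗ ℚ₂` for the CM sigma
function `σ` of the twist (Perrin-Riou's Lemme 2 at `v | 2` for `V_d`), binder-free; `(Σ₂, c₂) = (σ², 0)` -/

section Two

/-- `√-7 ∈ ℤ₂`: the étale `2`-torsion abscissa of `49a1` is a `2`-adic integer, i.e. `4e² + 5e + 2`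
has a root `e ∈ ℤ₂` (Hensel at `e₀ = 0`). [Serre 1973, Ch. II §3.3 Thm. 4; folklore]
[cite: Serre1973, Ch. II §3.3 Thm. 4] -/
private theorem exists_twoTorsionX_two : ∃ e : ℚ_[2], ‖e‖ ≤ 1 ∧ 4 * e ^ 2 + 5 * e + 2 = 0 := by
  let F : Polynomial ℤ_[2] := Polynomial.C 4 * Polynomial.X ^ 2 + Polynomial.C 5 * Polynomial.X + Polynomial.C 2
  have hF : ∀ z : ℤ_[2], F.aeval z = 4 * z ^ 2 + 5 * z + 2 := by intro z; simp [F]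
  have hF' : F.derivative.aeval (0 : ℤ_[2]) = 5 := by
    simp [F]
  have hnorm : ‖F.aeval (0 : ℤ_[2])‖ < ‖F.derivative.aeval (0 : ℤ_[2])‖ ^ 2 := by
    rw [hF, hF']
    have h2 : ‖(2 : ℤ_[2])‖ = (2 : ℝ)⁻¹ := by
      rw [show (2 : ℤ_[2]) = ((2 : ℕ) : ℤ_[2]) by norm_num, PadicInt.norm_p]; norm_num
    have h5 : ‖(5 : ℤ_[2])‖ = 1 := by
      rw [show (5 : ℤ_[2]) = ((5 : ℕ) : ℤ_[2]) by norm_num, PadicInt.norm_natCast_eq_one_iff]; decide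
    rw [show (4 : ℤ_[2]) * 0 ^ 2 + 5 * 0 + 2 = 2 by ring, h2, h5]
    norm_num
  obtain ⟨z, hz, -⟩ := hensels_lemma hnorm
  refine ⟨(z : ℚ_[2]), PadicInt.norm_le_one z, ?_⟩
  rw [hF] at hz
  have := congrArg ((↑) : ℤ_[2] → ℚ_[2]) hz
  push_cast at this
  exact this

/-- `ϖ = 3 + 4e = (1 ± √-7)/2` is a `2`-adic unit for `e ∈ ℤ₂`. [folklore] -/
private theorem norm_three_add_four_mul' {e : ℚ_[2]} (he : ‖e‖ ≤ 1) : ‖(3 : ℚ_[2]) + 4 * e‖ = 1 := by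
  have h3 : ‖(3 : ℚ_[2])‖ = 1 := by
    rw [show (3 : ℚ_[2]) = ((3 : ℕ) : ℚ_[2]) by norm_num, Padic.norm_natCast_eq_one_iff]; decide
  have h4 : ‖(4 : ℚ_[2]) * e‖ < 1 := by
    have h4' : ‖(4 : ℚ_[2])‖ < 1 := by
      rw [show (4 : ℚ_[2]) = ((4 : ℕ) : ℚ_[2]) by norm_num, Padic.norm_natCast_lt_one_iff]; decide
    rw [norm_mul]
    calc ‖(4 : ℚ_[2])‖ * ‖e‖ ≤ ‖(4 : ℚ_[2])‖ * 1 := by gcongr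
      _ < 1 := by rw [mul_one]; exact h4'
  have hne : ‖(3 : ℚ_[2])‖ ≠ ‖(4 : ℚ_[2]) * e‖ := by rw [h3]; exact (ne_of_lt h4).symm
  rw [Padic.add_eq_max_of_ne hne, h3, max_eq_left h4.le]

variable (V : WeierstrassCurve ℚ_[2]) [V.IsIntegral ℤ_[2]] {d : ℚ_[2]}

/-- **Perrin-Riou's Lemme 2 at `v | 2` for the twists `V_d` of `X₀(49)` good at `2`, squared currency:
`(σ², 0)` IS a Mazur–Tate sigma-squared pair of `V_d`** — for every `2`-integral `V/ℚ₂` with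
`a`-invariants `[1, -(3d+1)/4, 0, -2d², -d³]`, `d ∈ ℤ₂` (these are `ℤ₂`-minimal models with GOOD
ORDINARY reduction of the quadratic twists `49a1^{(d)} ⊗ ℚ₂`, `d ≡ 1 (mod 4)`, both classes
`d ≡ 1, 5 (mod 8)`; `d = 1` is `cm7_isMazurTateSigmaSqPair_sq_two`) and every normalised odd formal
solution `σ = z + ⋯ ∈ ℚ₂⟦z⟧` of the sigma equation `x = -D(Dσ/σ)` of `V` with constant `c = 0`
(`s₂ = 1/4` on this model): `σ² ∈ z² + z³ℤ₂⟦z⟧`, even under `[−1]`, satisfying the squared sigma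
equation. Proof = Perrin-Riou's with `π* = ϖ = (1 ± √-7)/2 ∈ ℤ₂ˣ`, `N(π*) = 2`: the CM `2`-isogeny
datum of §2 feeds the tree's `isMazurTateSigmaSqPair_sq_of_cmTwoIsogeny_two` (functional equation
`z²σ([ϖ]t)² = ϖ²σ⁴·(X - e_d z²)` + the coefficient induction «`1 - (π*^m - p)a_m t^m`»), with
`e_d = de ∈ ℤ₂`, `t_d = d²t`, `r₀ = e_d`, hence CM constant `c = (e_d - r₀)/(ϖ² - 2) = 0`. No binder.
[Perrin-Riou 1984, Ch. III §1.2 Lemme 2 (pp. 54–55)] [cite: Perrinriou1984, Ch. III §1.2 Lemme 2] -/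
theorem twist_isMazurTateSigmaSqPair_sq_two (hd : ‖d‖ ≤ 1) (ha₁ : V.a₁ = 1)
    (ha₂ : 4 * V.a₂ = -(3 * d + 1)) (ha₃ : V.a₃ = 0) (ha₄ : V.a₄ = -2 * d ^ 2) (ha₆ : V.a₆ = -d ^ 3)
    {σ : ℚ_[2]⟦X⟧} (hσ0 : constantCoeff σ = 0) (hσ1 : coeff 1 σ = 1) (hodd : V.IsFormallyOdd σ)
    (hODE : V.SatisfiesSigmaODE σ 0) : V.IsMazurTateSigmaSqPair (σ ^ 2) 0 := by
  obtain ⟨e, he1, he⟩ := exists_twoTorsionX_two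
  obtain ⟨T, hT0, hlog, hx⟩ := twist_exists_cmTwoIsogenyDatum V ha₁ ha₂ ha₃ ha₄ ha₆ he
  have hϖ : ‖(3 : ℚ_[2]) + 4 * e‖ = 1 := norm_three_add_four_mul' he1
  have hT : IsPadicInt T := isPadicInt_of_formalLog_subst_eq' _ hT0 hlog hϖ.le
  have hde : ‖d * e‖ ≤ 1 := by
    rw [norm_mul]; exact mul_le_one₀ hd (norm_nonneg _) he1
  have hb₂ : V.b₂ = -3 * d := by rw [b₂, ha₁]; linear_combination ha₂
  have hb₄ : V.b₄ = -4 * d ^ 2 := by rw [b₄, ha₁, ha₃, ha₄]; ring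
  have hb₆ : V.b₆ = -4 * d ^ 3 := by rw [b₆, ha₃, ha₆]; ring
  refine isMazurTateSigmaSqPair_sq_of_cmTwoIsogeny_two V hσ0 hσ1 hodd hODE hT0 hT hlog hϖ hde
    (t := d ^ 2 * (-(14 + 21 * e) / 4)) (r₀ := d * e) ?_ ?_ hx ?_
  · rw [hb₂, hb₄, hb₆]; linear_combination d ^ 3 * (e - 2) * he
  · rw [hb₂, hb₄]; linear_combination (-3 / 2 : ℚ_[2]) * d ^ 2 * he
  · ring

/-- **Binder-free existence of the CM sigma function of `V_d` and of its squared pair**: there is a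
normalised odd `σ ∈ z + z²ℚ₂⟦z⟧` with `x = -D(Dσ/σ)` on `V_d`, and `(σ², 0)` is a Mazur–Tate
sigma-squared pair. [Perrin-Riou 1984, Ch. III §1.2 (définition de `σ_v`, p. 53) and Lemme 2]
[cite: Perrinriou1984, Ch. III §1.2 Lemme 2] -/
theorem twist_exists_isMazurTateSigmaSqPair_sq_two (hd : ‖d‖ ≤ 1) (ha₁ : V.a₁ = 1)
    (ha₂ : 4 * V.a₂ = -(3 * d + 1)) (ha₃ : V.a₃ = 0) (ha₄ : V.a₄ = -2 * d ^ 2) (ha₆ : V.a₆ = -d ^ 3) :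
    ∃ σ : ℚ_[2]⟦X⟧, constantCoeff σ = 0 ∧ coeff 1 σ = 1 ∧ V.IsFormallyOdd σ ∧
      V.SatisfiesSigmaODE σ 0 ∧ V.IsMazurTateSigmaSqPair (σ ^ 2) 0 := by
  obtain ⟨σ, h0, h1, hodd, hODE⟩ := V.exists_isFormallyOdd_satisfiesSigmaODE_zero
  exact ⟨σ, h0, h1, hodd, hODE, twist_isMazurTateSigmaSqPair_sq_two V hd ha₁ ha₂ ha₃ ha₄ ha₆ h0 h1 hodd hODE⟩

/-- **`V_d` has EXACTLY ONE sigma-squared pair, binder-free** (`a₁ = 1 ∈ ℤ₂ˣ`: the tree's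
`existsUnique_isMazurTateSigmaSqPair_of_exists` fed by finite height, `unbounded_formalLog_two_of_norm_a₁_eq_one`).
[Mazur–Tate 1991, Thm. 3.1; Perrin-Riou 1984, Ch. III §1.2 Lemme 2] [cite: MazurTate1991, Thm. 3.1] -/
theorem twist_existsUnique_isMazurTateSigmaSqPair_two (hd : ‖d‖ ≤ 1) (ha₁ : V.a₁ = 1)
    (ha₂ : 4 * V.a₂ = -(3 * d + 1)) (ha₃ : V.a₃ = 0) (ha₄ : V.a₄ = -2 * d ^ 2) (ha₆ : V.a₆ = -d ^ 3) :
    ∃! Sc : ℚ_[2]⟦X⟧ × ℚ_[2], V.IsMazurTateSigmaSqPair Sc.1 Sc.2 := by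
  have ha : ‖V.a₁‖ = 1 := by rw [ha₁, norm_one]
  obtain ⟨σ, -, -, -, -, h⟩ := twist_exists_isMazurTateSigmaSqPair_sq_two V hd ha₁ ha₂ ha₃ ha₄ ha₆
  exact V.existsUnique_isMazurTateSigmaSqPair_of_exists (V.unbounded_formalLog_two_of_norm_a₁_eq_one ha)
    ⟨σ ^ 2, 0, h⟩

/-- **`(Σ₂, c₂) = (padicSigmaSq, padicSigmaSqConst)` of `V_d` IS a sigma-squared pair**, binder-free
(the receptacle of `PadicSigmaSq.lean` is inhabited by `(σ_CM², 0)`).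
[cite: Perrinriou1984, Ch. III §1.2 Lemme 2] [cite: Silverman2005DivPoly, §5 Rem. 2] -/
theorem twist_isMazurTateSigmaSqPair_padicSigmaSq_two (hd : ‖d‖ ≤ 1) (ha₁ : V.a₁ = 1)
    (ha₂ : 4 * V.a₂ = -(3 * d + 1)) (ha₃ : V.a₃ = 0) (ha₄ : V.a₄ = -2 * d ^ 2) (ha₆ : V.a₆ = -d ^ 3) :
    V.IsMazurTateSigmaSqPair V.padicSigmaSq V.padicSigmaSqConst := by
  obtain ⟨σ, -, -, -, -, h⟩ := twist_exists_isMazurTateSigmaSqPair_sq_two V hd ha₁ ha₂ ha₃ ha₄ ha₆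
  exact isMazurTateSigmaSqPair_padicSigmaSq (Or.inr ⟨σ ^ 2, 0, h⟩)

/-- **(L1) at `p = 2` for the twists `V_d`, BINDER-FREE: `Σ₂(V_d) = σ_CM²` and `c₂(V_d) = 0`.** The
tree's canonical squared `2`-adic sigma function of `V_d` is the square of Perrin-Riou's CM sigma
function `σ_v` (`v | 2`) of the twist — of any (= the) normalised odd formal solution `σ` of
`x = −D(Dσ/σ)` on `[1, -(3d+1)/4, 0, -2d², -d³]` — and its constant is `0` (`s₂ = 1/4`): the `2`-adic
sigma-squared height of the tree on `49a1^{(d)}`, `d ≡ 1 (mod 4)`, is the one built from `σ_v`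
(the `v | 2` ingredient of Perrin-Riou's `h_ρ`, pp. 56–57). No printed fact is assumed.
[Perrin-Riou 1984, Ch. III §1.2 Lemme 2, p. 54; Mazur–Tate 1991, Thm. 3.1]
[cite: Perrinriou1984, Ch. III §1.2 Lemme 2] [cite: MazurTate1991, Thm. 3.1] -/
theorem twist_padicSigmaSq_eq_sq_two (hd : ‖d‖ ≤ 1) (ha₁ : V.a₁ = 1)
    (ha₂ : 4 * V.a₂ = -(3 * d + 1)) (ha₃ : V.a₃ = 0) (ha₄ : V.a₄ = -2 * d ^ 2) (ha₆ : V.a₆ = -d ^ 3)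
    {σ : ℚ_[2]⟦X⟧} (hσ0 : constantCoeff σ = 0) (hσ1 : coeff 1 σ = 1) (hodd : V.IsFormallyOdd σ)
    (hODE : V.SatisfiesSigmaODE σ 0) : V.padicSigmaSq = σ ^ 2 ∧ V.padicSigmaSqConst = 0 := by
  obtain ⟨Sc, -, huniq⟩ := twist_existsUnique_isMazurTateSigmaSqPair_two V hd ha₁ ha₂ ha₃ ha₄ ha₆
  have e1 := huniq (_, _) (twist_isMazurTateSigmaSqPair_padicSigmaSq_two V hd ha₁ ha₂ ha₃ ha₄ ha₆)
  have e2 := huniq (σ ^ 2, 0) (twist_isMazurTateSigmaSqPair_sq_two V hd ha₁ ha₂ ha₃ ha₄ ha₆ hσ0 hσ1 hodd hODE)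
  have e := e1.trans e2.symm
  exact ⟨congrArg Prod.fst e, congrArg Prod.snd e⟩

/-- **The squared Mazur–Tate constant of `V_d` at `2` is `0`** (`s₂ = 1/4` on this model), binder-free.
[cite: Perrinriou1984, Ch. III §1.2 Lemme 2] -/
theorem twist_padicSigmaSqConst_two (hd : ‖d‖ ≤ 1) (ha₁ : V.a₁ = 1)
    (ha₂ : 4 * V.a₂ = -(3 * d + 1)) (ha₃ : V.a₃ = 0) (ha₄ : V.a₄ = -2 * d ^ 2) (ha₆ : V.a₆ = -d ^ 3) :
    V.padicSigmaSqConst = 0 := by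
  obtain ⟨σ, h0, h1, hodd, hODE, -⟩ := twist_exists_isMazurTateSigmaSqPair_sq_two V hd ha₁ ha₂ ha₃ ha₄ ha₆
  exact (twist_padicSigmaSq_eq_sq_two V hd ha₁ ha₂ ha₃ ha₄ ha₆ h0 h1 hodd hODE).2

end Two

end WeierstrassCurve

/-! ### §4. Over `ℚ`: the integral models `W_k = [1, -(3k+1), 0, -2(4k+1)², -(4k+1)³]` of the twists
`49a1^{(d)}`, `d = 4k + 1` — (L1) at `2` and the canonical `2`-adic height datum (sigma-squared form),
binder-free -/

namespace Literature.NumberTheory.EllipticCurves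

open _root_.WeierstrassCurve

section Rat

variable (W : WeierstrassCurve ℚ) (k : ℤ)

/-- The `a`-invariants of `W_k ⊗ ℚ₂` in the shape of §2–§3, with `d = 4k + 1 ∈ ℤ₂`. [folklore] -/
private theorem twistModel_baseChange_a
    (hW : W = ⟨1, -(3 * (k : ℚ) + 1), 0, -2 * (4 * (k : ℚ) + 1) ^ 2, -(4 * (k : ℚ) + 1) ^ 3⟩) :
    (W.baseChange ℚ_[2]).a₁ = 1 ∧
      4 * (W.baseChange ℚ_[2]).a₂ = -(3 * (4 * (k : ℚ_[2]) + 1) + 1) ∧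
      (W.baseChange ℚ_[2]).a₃ = 0 ∧
      (W.baseChange ℚ_[2]).a₄ = -2 * (4 * (k : ℚ_[2]) + 1) ^ 2 ∧
      (W.baseChange ℚ_[2]).a₆ = -(4 * (k : ℚ_[2]) + 1) ^ 3 := by
  subst hW
  refine ⟨?_, ?_, ?_, ?_, ?_⟩
  · simp [WeierstrassCurve.baseChange]
  · simp only [WeierstrassCurve.baseChange, WeierstrassCurve.map_a₂, map_neg, map_add, map_mul, map_one,
      map_ofNat, map_intCast]
    ring
  · simp [WeierstrassCurve.baseChange]
  · simp [WeierstrassCurve.baseChange]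
  · simp [WeierstrassCurve.baseChange]

/-- `d = 4k + 1` is a `2`-adic integer. [folklore] -/
private theorem norm_four_mul_add_one_le : ‖(4 * (k : ℚ_[2]) + 1)‖ ≤ 1 := by
  have h := Padic.norm_int_le_one (p := 2) (4 * k + 1)
  push_cast at h
  exact h

/-- `W_k` has integer coefficients. [folklore] -/
private theorem twistModel_isIntegral
    (hW : W = ⟨1, -(3 * (k : ℚ) + 1), 0, -2 * (4 * (k : ℚ) + 1) ^ 2, -(4 * (k : ℚ) + 1) ^ 3⟩) :
    W.IsIntegral ℤ := by
  subst hW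
  exact WeierstrassCurve.isIntegral_of_exists_lift ℤ ⟨1, by simp⟩
    ⟨-(3 * k + 1), by rw [eq_intCast]; push_cast; ring⟩ ⟨0, by simp⟩
    ⟨-2 * (4 * k + 1) ^ 2, by rw [eq_intCast]; push_cast; ring⟩
    ⟨-(4 * k + 1) ^ 3, by rw [eq_intCast]; push_cast; ring⟩

/-- **Discriminant of `W_k`**: `Δ(W_k) = -343·(4k+1)⁶ = Δ(49a1)·d⁶` (so `W_k` is a `ℤ₂`-minimal model
with good reduction at `2`, and a global minimal model of `49a1^{(4k+1)}` whenever `4k + 1` is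
squarefree: `ord_ℓ Δ ∈ {0, 3, 6} < 12`). [Silverman AEC III.1, VII.1] [cite: SilvermanAEC2009, III.1] -/
theorem cm7Twist_Δ
    (hW : W = ⟨1, -(3 * (k : ℚ) + 1), 0, -2 * (4 * (k : ℚ) + 1) ^ 2, -(4 * (k : ℚ) + 1) ^ 3⟩) :
    W.Δ = -343 * (4 * (k : ℚ) + 1) ^ 6 := by
  subst hW
  simp only [WeierstrassCurve.Δ, WeierstrassCurve.b₂, WeierstrassCurve.b₄, WeierstrassCurve.b₆,
    WeierstrassCurve.b₈]
  ring

/-- `W_k` is an elliptic curve (`Δ ≠ 0`: `4k + 1` is odd). [cite: SilvermanAEC2009, III.1] -/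
theorem cm7Twist_isElliptic
    (hW : W = ⟨1, -(3 * (k : ℚ) + 1), 0, -2 * (4 * (k : ℚ) + 1) ^ 2, -(4 * (k : ℚ) + 1) ^ 3⟩) :
    W.IsElliptic := by
  refine ⟨isUnit_iff_ne_zero.mpr ?_⟩
  rw [cm7Twist_Δ W k hW]
  have hk : (4 * (k : ℚ) + 1) ≠ 0 := by
    intro h
    have h' : ((4 * k + 1 : ℤ) : ℚ) = 0 := by push_cast; exact h
    have h'' : (4 * k + 1 : ℤ) = 0 := by exact_mod_cast h'
    omega
  exact mul_ne_zero (by norm_num) (pow_ne_zero 6 hk)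

/-- **Lemme 2 at `v | 2` for `49a1^{(4k+1)}` on its integral model `W_k`**: for every normalised odd
formal solution `σ` of the sigma equation of `W_k ⊗ ℚ₂` with constant `0`, `(σ², 0)` is a Mazur–Tate
sigma-squared pair — binder-free. [cite: Perrinriou1984, Ch. III §1.2 Lemme 2] -/
theorem cm7Twist_isMazurTateSigmaSqPair_sq_two
    (hW : W = ⟨1, -(3 * (k : ℚ) + 1), 0, -2 * (4 * (k : ℚ) + 1) ^ 2, -(4 * (k : ℚ) + 1) ^ 3⟩)
    {σ : ℚ_[2]⟦X⟧} (hσ0 : constantCoeff σ = 0) (hσ1 : coeff 1 σ = 1)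
    (hodd : (W.baseChange ℚ_[2]).IsFormallyOdd σ) (hODE : (W.baseChange ℚ_[2]).SatisfiesSigmaODE σ 0) :
    (W.baseChange ℚ_[2]).IsMazurTateSigmaSqPair (σ ^ 2) 0 := by
  haveI := twistModel_isIntegral W k hW
  obtain ⟨ha₁, ha₂, ha₃, ha₄, ha₆⟩ := twistModel_baseChange_a W k hW
  exact twist_isMazurTateSigmaSqPair_sq_two _ (norm_four_mul_add_one_le k) ha₁ ha₂ ha₃ ha₄ ha₆ hσ0 hσ1
    hodd hODE

/-- **The CM sigma function of `49a1^{(4k+1)} ⊗ ℚ₂` exists and `(σ², 0)` is a sigma-squared pair**,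
binder-free. [cite: Perrinriou1984, Ch. III §1.2 Lemme 2] -/
theorem cm7Twist_exists_isMazurTateSigmaSqPair_sq_two
    (hW : W = ⟨1, -(3 * (k : ℚ) + 1), 0, -2 * (4 * (k : ℚ) + 1) ^ 2, -(4 * (k : ℚ) + 1) ^ 3⟩) :
    ∃ σ : ℚ_[2]⟦X⟧, constantCoeff σ = 0 ∧ coeff 1 σ = 1 ∧ (W.baseChange ℚ_[2]).IsFormallyOdd σ ∧
      (W.baseChange ℚ_[2]).SatisfiesSigmaODE σ 0 ∧ (W.baseChange ℚ_[2]).IsMazurTateSigmaSqPair (σ ^ 2) 0 := by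
  haveI := twistModel_isIntegral W k hW
  obtain ⟨ha₁, ha₂, ha₃, ha₄, ha₆⟩ := twistModel_baseChange_a W k hW
  exact twist_exists_isMazurTateSigmaSqPair_sq_two _ (norm_four_mul_add_one_le k) ha₁ ha₂ ha₃ ha₄ ha₆

/-- **`49a1^{(4k+1)} ⊗ ℚ₂` (model `W_k`) has EXACTLY ONE sigma-squared pair**, binder-free.
[cite: MazurTate1991, Thm. 3.1] [cite: Perrinriou1984, Ch. III §1.2 Lemme 2] -/
theorem cm7Twist_existsUnique_isMazurTateSigmaSqPair_two
    (hW : W = ⟨1, -(3 * (k : ℚ) + 1), 0, -2 * (4 * (k : ℚ) + 1) ^ 2, -(4 * (k : ℚ) + 1) ^ 3⟩) :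
    ∃! Sc : ℚ_[2]⟦X⟧ × ℚ_[2], (W.baseChange ℚ_[2]).IsMazurTateSigmaSqPair Sc.1 Sc.2 := by
  haveI := twistModel_isIntegral W k hW
  obtain ⟨ha₁, ha₂, ha₃, ha₄, ha₆⟩ := twistModel_baseChange_a W k hW
  exact twist_existsUnique_isMazurTateSigmaSqPair_two _ (norm_four_mul_add_one_le k) ha₁ ha₂ ha₃ ha₄ ha₆

/-- **(L1) at `p = 2` for `49a1^{(4k+1)}` (model `W_k`), BINDER-FREE: `Σ₂ = σ_CM²`, `c₂ = 0`.**
[cite: Perrinriou1984, Ch. III §1.2 Lemme 2] [cite: MazurTate1991, Thm. 3.1] -/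
theorem cm7Twist_padicSigmaSq_eq_sq_two
    (hW : W = ⟨1, -(3 * (k : ℚ) + 1), 0, -2 * (4 * (k : ℚ) + 1) ^ 2, -(4 * (k : ℚ) + 1) ^ 3⟩)
    {σ : ℚ_[2]⟦X⟧} (hσ0 : constantCoeff σ = 0) (hσ1 : coeff 1 σ = 1)
    (hodd : (W.baseChange ℚ_[2]).IsFormallyOdd σ) (hODE : (W.baseChange ℚ_[2]).SatisfiesSigmaODE σ 0) :
    (W.baseChange ℚ_[2]).padicSigmaSq = σ ^ 2 ∧ (W.baseChange ℚ_[2]).padicSigmaSqConst = 0 := by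
  haveI := twistModel_isIntegral W k hW
  obtain ⟨ha₁, ha₂, ha₃, ha₄, ha₆⟩ := twistModel_baseChange_a W k hW
  exact twist_padicSigmaSq_eq_sq_two _ (norm_four_mul_add_one_le k) ha₁ ha₂ ha₃ ha₄ ha₆ hσ0 hσ1 hodd hODE

/-- `c₂(49a1^{(4k+1)}) = 0` on `W_k`, binder-free. [cite: Perrinriou1984, Ch. III §1.2 Lemme 2] -/
theorem cm7Twist_padicSigmaSqConst_two
    (hW : W = ⟨1, -(3 * (k : ℚ) + 1), 0, -2 * (4 * (k : ℚ) + 1) ^ 2, -(4 * (k : ℚ) + 1) ^ 3⟩) :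
    (W.baseChange ℚ_[2]).padicSigmaSqConst = 0 := by
  haveI := twistModel_isIntegral W k hW
  obtain ⟨ha₁, ha₂, ha₃, ha₄, ha₆⟩ := twistModel_baseChange_a W k hW
  exact twist_padicSigmaSqConst_two _ (norm_four_mul_add_one_le k) ha₁ ha₂ ha₃ ha₄ ha₆

/-- A sigma-squared pair of `W_k ⊗ ℚ₂` exists (it is `(σ_CM², 0)`) — the input of the tree's
binder-free cores `exists(Unique)_isCanonicalSq(K)_of_exists`. [cite: Perrinriou1984, Ch. III §1.2 Lemme 2] -/
theorem cm7Twist_exists_isMazurTateSigmaSqPair_two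
    (hW : W = ⟨1, -(3 * (k : ℚ) + 1), 0, -2 * (4 * (k : ℚ) + 1) ^ 2, -(4 * (k : ℚ) + 1) ^ 3⟩) :
    ∃ Sq : PowerSeries ℚ_[2], ∃ c : ℚ_[2], (W.baseChange ℚ_[2]).IsMazurTateSigmaSqPair Sq c := by
  obtain ⟨σ, -, -, -, -, h⟩ := cm7Twist_exists_isMazurTateSigmaSqPair_sq_two W k hW
  exact ⟨σ ^ 2, 0, h⟩

/-- **THE canonical `2`-adic height datum of `49a1^{(4k+1)}/ℚ` (model `W_k`) exists, sigma-squared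
form — no binder.** [Mazur–Stein–Tate 2006, §2.7; Perrin-Riou 1984, Ch. III §1.2]
[cite: MazurSteinTate2006, §2.7] -/
theorem cm7Twist_exists_isCanonicalSq_two [W.IsElliptic]
    (hW : W = ⟨1, -(3 * (k : ℚ) + 1), 0, -2 * (4 * (k : ℚ) + 1) ^ 2, -(4 * (k : ℚ) + 1) ^ 3⟩) :
    ∃ D : PAdicHeightData W 2, D.IsCanonicalSq := by
  haveI := twistModel_isIntegral W k hW
  exact exists_isCanonicalSq_of_exists W 2 (cm7Twist_exists_isMazurTateSigmaSqPair_two W k hW)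

/-- **… and it is unique when `W_k` is globally minimal** (e.g. `4k + 1` squarefree) — no binder.
[Mazur–Stein–Tate 2006, §1, §2.7] [cite: MazurSteinTate2006, §2.7] -/
theorem cm7Twist_existsUnique_isCanonicalSq_two [W.IsElliptic] [W.IsGloballyMinimal]
    (hW : W = ⟨1, -(3 * (k : ℚ) + 1), 0, -2 * (4 * (k : ℚ) + 1) ^ 2, -(4 * (k : ℚ) + 1) ^ 3⟩) :
    ∃! D : PAdicHeightData W 2, D.IsCanonicalSq :=
  existsUnique_isCanonicalSq_of_exists W 2 (cm7Twist_exists_isMazurTateSigmaSqPair_two W k hW)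

/-- **THE canonical `2`-adic `K`-datum of `49a1^{(4k+1)}` over a quadratic `K` with `d_K ≡ 1 (mod 8)`
exists, sigma-squared form — no binder** (`2` splits in `K`: `card_ringHom_padic_two_of_discr_mod_eight`).
[Mazur–Stein–Tate 2006, §2.8; Marcus Ch. 3 Thm. 25] [cite: MazurSteinTate2006, §2.8]
[cite: Marcus2018, Ch. 3 Thm. 25] -/
theorem cm7Twist_exists_isCanonicalSqK_two_of_discr_mod_eight [W.IsElliptic]
    (hW : W = ⟨1, -(3 * (k : ℚ) + 1), 0, -2 * (4 * (k : ℚ) + 1) ^ 2, -(4 * (k : ℚ) + 1) ^ 3⟩)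
    (K : Type) [Field K] [NumberField K] (h2 : Module.finrank ℚ K = 2) (h8 : NumberField.discr K % 8 = 1) :
    ∃ DK : PAdicHeightDataK W 2 K, DK.IsCanonicalSq := by
  haveI := twistModel_isIntegral W k hW
  exact exists_isCanonicalSqK_of_exists W K 2 (cm7Twist_exists_isMazurTateSigmaSqPair_two W k hW)
    (card_ringHom_padic_two_of_discr_mod_eight K h2 h8)

/-- **… exists AND is unique when `W_k ⊗ K` is globally minimal** — no printed binder.
[Mazur–Stein–Tate 2006, §1, §2.8] [cite: MazurSteinTate2006, §2.8] [cite: Marcus2018, Ch. 3 Thm. 25] -/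
theorem cm7Twist_existsUnique_isCanonicalSqK_two [W.IsElliptic]
    (hW : W = ⟨1, -(3 * (k : ℚ) + 1), 0, -2 * (4 * (k : ℚ) + 1) ^ 2, -(4 * (k : ℚ) + 1) ^ 3⟩)
    (K : Type) [Field K] [NumberField K] [(W.baseChange K).IsGloballyMinimal]
    (h2 : Module.finrank ℚ K = 2) (h8 : NumberField.discr K % 8 = 1) :
    ∃! DK : PAdicHeightDataK W 2 K, DK.IsCanonicalSq := by
  haveI := twistModel_isIntegral W k hW
  exact existsUnique_isCanonicalSqK_of_exists W K 2 (cm7Twist_exists_isMazurTateSigmaSqPair_two W k hW)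
    (card_ringHom_padic_two_of_discr_mod_eight K h2 h8)

/-- **Over `K` with `d_K = −7`** (the CM field `ℚ(√−7)`, the field of LTYZ §§3–9): the `2`-adic
`K`-datum of `49a1^{(4k+1)}` (model `W_k`, `W_k ⊗ K` globally minimal), sigma-squared form, exists and
is unique. [cite: MazurSteinTate2006, §2.8] -/
theorem cm7Twist_existsUnique_isCanonicalSqK_two_of_discr_eq_neg_seven [W.IsElliptic]
    (hW : W = ⟨1, -(3 * (k : ℚ) + 1), 0, -2 * (4 * (k : ℚ) + 1) ^ 2, -(4 * (k : ℚ) + 1) ^ 3⟩)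
    (K : Type) [Field K] [NumberField K] [(W.baseChange K).IsGloballyMinimal]
    (h2 : Module.finrank ℚ K = 2) (h7 : NumberField.discr K = -7) :
    ∃! DK : PAdicHeightDataK W 2 K, DK.IsCanonicalSq :=
  cm7Twist_existsUnique_isCanonicalSqK_two W k hW K h2 (by rw [h7]; decide)

end Rat

end Literature.NumberTheory.EllipticCurves
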